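/-
Copyright: statement-level skeleton of a published paper (lit-balaban cell, Phase-2 proof seat p26 gen 33). No claims beyond
what the kernel checks below.
-/
import Mathlib
import Literature.MathematicalPhysics.QuantumFieldTheory.Balaban1983to89.B3Eq330Members
import Literature.MathematicalPhysics.QuantumFieldTheory.Balaban1983to89.B3Graph24Unique
import Literature.MathematicalPhysics.QuantumFieldTheory.Balaban1983to89.B3Sect3WickCancellation

/-!
# B3 — T. Bałaban, *(Higgs)₂,₃ quantum fields in a finite volume. III. Renormalization*, CMP **88** (1983) 411–445
[Balaban1983Higgs3] — p. 435 [PDF 25]: the PICTURES **(3.7)** (the mass-renormalization counterterms of the graphs (3.6)) and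
**(3.8)** (the first graph of (3.6) minus the picture of its counterterm) AS DRAWN OBJECTS of the concrete graph model
(`B3Cor23Concrete.Graph`, line kinds visible) with the LOCALIZATION of their external legs (p. 417), the count datum `graph38` of
this lineage DERIVED from the drawn graph, and the DICTIONARY from the drawn objects to the typed expressions ((3.9) `expr39`,
the graph-with-counterterm carrier (3.19) `subtracted319`)

statement-level skeleton of published theorems with citation tags; proofs where landed; nothing here is a claim about
the Yang–Mills mass gap

PDF held: `paper:balaban1983-higgs-2-3-quantum-fields-finite-volume` (journal page = PDF page + 410); pp. 415, 417, 423, 424, 435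
[PDF 5, 7, 13, 14, 25] read in the OCR text (`p0025.txt`) and on the ×2 render
`run/shared/lean/pub/pub-balaban/b2b-balaban-ref1/pages/1983-cmp88-higgs23-III/1983-cmp88-higgs23-III-p025-x2.png` (the pictures
(3.6)–(3.8), re-read by this seat 2026-08-22).

CITATION HEADER (lean-in-tree rule).  lit-balaban TYPED SKELETON (HOME `run/shared/lean/pub/lit-balaban/`), PHASE 2, seat p26 gen 33
(unit `lit-balaban-p26`; TAKING line HOME/STATUS.md 2026-08-22T21:36Z); free target named by the fold owner r15 g13 (seat INBOX
2026-08-22T21:33:59Z) = lead g10's HEAD-WORD CRITERION for row **B3.Eq3.6-3.9** (HOME/INBOX 2026-08-22T21:19:00Z, verbatim: *"(3.7)₁ and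
(3.8) typed as model graphs in the same model as (3.6) (line kinds visible), with the count datum `graph38` ∕ D = 0 DERIVED from the
drawn object and (3.8) identified with the (3.6)₁-with-(3.7)₁-insertion picture at graph level or, if the model has no composition,
by an explicit dictionary lemma to `expr39`; the (3.7)₂,₃ counterterm pictures may keep entering through p18's `tadpole_cancellation`
sentence"*), `B3-CLOSURE.md` v1.13 §5 item 7.  ROWS **B3.Eq3.6-3.9** of `HOME/lit-balaban-r15/ROWS-B3.md` (fold owner r15, referee
ref-4).  CONSUMES BY NAME: p18 gen 3's drawn graphs (3.6) `B3Sect3LowestOrderGraphs.g36a/g36b/g36c` (p248264) and their model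
`B3Cor23Concrete.Graph` (legs `Leg`, pairing `other`, degree `deg`), p18 gen 2's drawn graph (2.4) `B3Graph24Unique.graph24`
(`graph24_deg`), this lineage's count datum `B3Eq312Member.graph38` (= `bubble δ38`; `is24Block_graph38`, `degQ_one_graph38`) and
kernel `B3Eq330Members.sigma39` with `expr39_eq_neg_subtracted319`, r15's (3.9) `B3Sect3ScalarSelfEnergy.expr39` and (3.19)
`B3Sect3Subtraction319.subtracted319`, p18 gen 3's `B3Sect3WickCancellation.tadpole_cancellation`.

THE PRINTED TEXT (verbatim).  p. 435 [PDF 25]: *"Let us start with self-energy graphs for scalar fields. The graphs of lowest order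
are [three pictures] (D = −d + 2), (3.6) and the renormalized class G_ren contains the corresponding mass renormalization
counterterms also: (−1)·[picture], (−1)·[picture], (−1)·[picture] (3.7) The two last terms in (3.7) cancel exactly the two last
terms in (3.6), so the expressions containing these terms vanish (Wick ordering). We will consider in detail an expression
corresponding to [picture] − [picture] (3.8) … The expression corresponding to (3.8) is (3.9)"*; p. 417 [PDF 7]: *"If a graph G
representing Σ^ε_G(x − x′) has the external legs localized in x, x′, then δm²_G = Σ_{x′∈T_ε} ε^dΣ^ε_G(x − x′) will be represented by
the same graph G but with both external legs localized in x and with the summation over x′."*; p. 423 [PDF 13]: *"Thus the degree of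
G is the same as the degree of a graph G′ obtained from G by attaching the corresponding graphs to the mass renormalization
vertices"*; p. 415 legend (1.17): straight line = φ′, wavy line = A′, arrowhead = the covariant differentiation.
READING OF THE PICTURES (p. 435 render).  (3.7)₁ = (−1)·[the vertex x carrying BOTH external φ′-legs, from which the A′-line (wavy)
and the differentiated φ′-line (straight, arrowed) run to the second vertex x′ where they meet] — by p. 417 *the same graph* as
(3.6)₁ (p18's `g36a`: two vertices (1.8)_{1,0}, the φ′-line through both differentiated legs, the A′-line) *with both external legs
localized in x*; (3.7)₂ = (−1)·(3.6)₂ and (3.7)₃ = (−1)·(3.6)₃ (one-vertex tadpoles: both legs are at x already); (3.8) = [(3.6)₁]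
− [the picture of (3.7)₁].

WHAT IS TYPED / PROVED (definitions with bodies + theorems; no `Prop` fact, no `sorry`; standard axioms).
§1 the drawn graph (3.6)₁ in CLOSED form (`kind36`, `sLeg`, `vLeg`, `other36` — p18's `g36a` definitionally: `g36a_kind`,
`g36a_other`), `LocPicture`: a model graph together with the LOCALIZATION VERTEX of each of its legs (p. 417; internal legs stay at their own
vertex, `loc_int`); `LocPicture.natural`; the pictures `pic36a/b/c` ((3.6), natural localization), **`pic37a`** ((3.7)₁: `g36a` with
both external legs at the vertex `x = 0`), `pic37b/c` ((3.7)₂,₃ = the tadpoles), the signed list **`gren37`** = (3.7) with its three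
printed coefficients `(−1)`, and **`pic38 : PictureDiff`** = (3.8) as the ordered formal difference [(3.6)₁] − [(3.7)₁'s picture]
(the model has no composition of graphs; the lead's fallback clause); kernel facts: the external legs of `g36a` are exactly the two
undifferentiated φ′-legs (`g36a_other_eq_none_iff`), `pic37a` puts both at `x` (`loc37_eq`, `loc37_ext`) and differs from `pic36a` exactly
there (`pic37a_ne_pic36a`); line kinds: the φ′-line of `g36a` joins the two differentiated (arrowed) legs, the A′-line the two wavy
legs (`g36a_other_sLeg0`, `g36a_other_vLeg`).
§2 THE COUNT DATUM DERIVED FROM THE DRAWN OBJECT: `legDiffs`/`legAvg` (differentiations ∕ averaged-A′-leg flag carried by a leg of a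
model graph), `LineEnum` (an enumeration of the internal lines of a model graph as pairs of legs: `pair`, `cover`, `nodup`, `touches`),
**`countsOf`** (the p19 `Counts` datum of a model graph with enumerated lines: endpoints, differentiations of `v` acting on `l`, averaged
legs, proper η-power `etaCount − d`), the enumeration `enum36a` of `g36a` (`fst36`/`snd36`, its four properties DECIDED: `enum36_props`; line `0` = the φ′-line = a
SCALAR line, line `1` = the A′-line = a VECTOR line: `enum36a_kinds`; the pattern read off the legs IS `δ38`: `pattern36`) and **`countsOf_g36a : countsOf (g36a n̄ hn) (enum36a hn) 3 2 1 ⋯ = graph38`** — the count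
datum of `B3Eq312Member` IS the one read off the drawn graph; consequently **D(G′₁) = 0 for the φ′-line block, derived**
(`degQ_one_countsOf_g36a`, `is24Block_countsOf_g36a`), and at the level of DRAWN graphs: opening the A′-line of (3.6)₁ gives EXACTLY
p18's drawn graph (2.4) (`graph24_kind_other_inl`, `graph24_other_inr`: same vertices, same φ′-line, A′-legs external), whose degree is `0` in every
dimension (`graph24_deg`, p18) — `deg_sub24_of_g36a`.
§3 THE DICTIONARY TO THE EXPRESSIONS: for a localized picture with two chosen external φ′-legs `e, e′` and a kernel depending on the
vertex positions, `LocPicture.amp` := Σ over all vertex positions `xs : vertices → T` of η^{(#vertices)·d}·⟪φ(xs(loc e)), K(xs)φ′(xs(loc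
e′))⟫ (the legs' fields evaluated AT THEIR LOCALIZATION VERTICES — the content of p. 417); `PictureDiff.amp` = the difference;
**`amp_pic36a`** (= Σ_{x,x′}η^{2d}φ(x)·Σ(x,x′)φ′(x′), the graph term), **`amp_pic37a`** (= Σ_{x,x′}η^{2d}φ(x)·Σ(x,x′)φ′(x) = Σ_xη^dφ(x)·
(Σ_{x′}η^dΣ(x,x′))φ′(x), the counterterm *"with the summation over x′"*), **`amp_pic38 : (pic38 hn).amp … η Σ φ φ′ = subtracted319 η Σ φ
φ′`** (r15's graph-with-counterterm carrier (3.19)) and **`expr39_eq_neg_amp_pic38`**: r15's (3.9) `expr39 η q G_{(j)}(0) G_{(j′)} g g′ φ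
φ′ = −(pic38 hn).amp … η Σ₃₉ φ φ′` with the kernel `Σ₃₉ = sigma39` of this lineage READ OFF THE LINES of (3.6)₁ (doubly differentiated
φ′-line ↦ Σ_μ(∂^η_μG_{(j)}(0)∂^{η*}_μ)(x,x′), A′-line ↦ G_{(j′)}(x,x′), vertices (1.8)_{1,0} ↦ q g(x), q g′(x′)); the exterior sign is
print's ((3.9) opens with "−Σ_{x,x′}").  §4 the WICK sentence for (3.6)₂,₃/(3.7)₂,₃ at picture level (`pic37b_eq`, `pic37c_eq`: the
counterterm pictures ARE the tadpole pictures, coefficient `−1`; `gren37_coeffs`) — the expression-level cancellation is p18's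
`tadpole_cancellation`, cited not restated (the one-vertex dictionary is `amp_natural_oneVertex`).
CRITERION MAP (lead g10's head word of 2026-08-22T21:19:00Z, clause by clause, for the fold owner's re-lead cell; r15 g13's wish
(i) of 21:38:17Z).  (A) «(3.7)₁ and (3.8) typed as model graphs in the same model as (3.6) (line kinds visible)» ↦ §1: `LocPicture`
(p18's `Graph` + the p. 417 localization), `pic37a` ((3.7)₁), `pic37b`/`pic37c` + `gren37` ((3.7) with its three `(−1)`), `pic38`
((3.8) as [(3.6)₁] − [(3.7)₁'s picture]); line kinds `g36a_other_sLeg0` (φ′-line through the arrowed legs) / `g36a_other_vLeg` (A′-line)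
/ `enum36a_kinds`; external legs `g36a_other_eq_none_iff`; localization `loc37_eq`, `loc37_ext`, `pic37a_ne_pic36a`.  (B) «the count
datum `graph38` ∕ D = 0 DERIVED from the drawn object» ↦ §2: `countsOf` (model graph + `LineEnum` ↦ p19 `Counts`), `enum36a`
(`enum36_props`, `pattern36`), `countsOf_g36a` (= `graph38`), `degQ_one_countsOf_g36a` / `is24Block_countsOf_g36a` (D(G′₁) = 0, the
(2.4)-block) / `degQ_two_countsOf_g36a`, and at drawn level `graph24_kind_other_inl` / `graph24_other_inr` / `deg_sub24_of_g36a` ((2.4) =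
(3.6)₁ with the A′-line opened, D = 0 by p18's `graph24_deg`).  (C) «(3.8) identified with the (3.6)₁-with-(3.7)₁-insertion picture at
graph level or, if the model has no composition, by an explicit dictionary lemma to `expr39`» ↦ the model has no composition; §3:
`LocPicture.amp`, `amp_pic36a`, `amp_pic37a`, `amp_pic37a_resummed`, `amp_pic38` (= r15's `subtracted319`), `expr39_eq_neg_amp_pic38`
(= r15's `expr39` up to print's exterior sign), `amp_pic36a_pic37a_sigma39` (= `graphTerm39` ∕ `counterTerm39`).  (D) «the (3.7)₂,₃
counterterm pictures may keep entering through p18's `tadpole_cancellation` sentence» ↦ `pic37b_eq`, `pic37c_eq`, `gren37_coeffs`,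
`amp_natural_oneVertex` + p18's `B3Sect3WickCancellation.tadpole_cancellation` (cited).
HONEST SCOPE.  (i) The localization datum and the formal difference are this file's READING of p. 417 / (3.8) on top of p18's model,
which has no composition of graphs and no amplitude map of its own; the dictionary `amp` is stated for pictures with two chosen
external φ′-legs and a position-dependent kernel supplied by the caller (here `sigma39`, whose factors are the printed propagators of
the two lines and the printed vertex factors) — it is NOT a general Feynman-rule evaluator of the model.  (ii) `d = 3`, `L = 2`,
`δ₁ = 1` in the count datum, as in `B3Eq312Member`.  (iii) (3.7)₂,₃: typed as signed pictures only; their expressions enter through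
`tadpole_cancellation` (p18).  (iv) Nothing analytic is added: (3.9)–(3.17) are r15's/p27's/this lineage's other files.
Unit `lit-balaban-p26` gen 33 (literature-prover-lit-balaban-p26-g33-0), HOME `run/shared/lean/pub/lit-balaban/`, 2026-08-22.
-/

open Finset

namespace Literature.MathematicalPhysics.QuantumFieldTheory.Balaban1983to89.B3Eq37Pictures

/-! ## §1 Pictures with localized external legs: (3.6), (3.7), (3.8) as drawn objects -/

section Pictures

open B3Prop1 B3Cor23Concrete B3Sect3LowestOrderGraphs B3Graph24Unique

/-- **A picture with LOCALIZED legs** (p. 417 [PDF 7], verbatim: *"δm²_G … will be represented by the same graph G but with both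
external legs localized in x and with the summation over x′"*): a graph of p18's model together with, for every leg, the vertex AT
WHICH ITS FIELD IS EVALUATED; legs lying on internal lines stay at their own vertex (only external legs are relocated).
[cite: Balaban1983Higgs3, p.417] -/
structure LocPicture (nbar : ℕ) where
  /-- the drawn graph (vertices of the catalogue, φ′/A′-legs, lines) -/
  G : Graph nbar
  /-- the localization vertex of each leg -/
  loc : Leg G.kind → Fin G.nV
  /-- internal legs are not relocated -/
  loc_int : ∀ x, (G.other x).isSome → loc x = x.1

variable {nbar : ℕ}

/-- The natural localization: every leg at its own vertex (the pictures (3.6), and every picture without a counterterm reading).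
[cite: Balaban1983Higgs3, (3.6) p.435] -/
def LocPicture.natural (G : Graph nbar) : LocPicture nbar := ⟨G, fun x => x.1, fun _ _ => rfl⟩

/-! ### The drawn graph (3.6)₁ in closed form: its vertices, legs and lines (p18's `g36a`, definitionally) -/

/-- The two vertices `x = 0`, `x′ = 1` of (3.6)₁ are both of the kind (1.8)_{n=1,n′=0} (p18's `g36a`). [cite: Balaban1983Higgs3, (3.6) p.435] -/
def kind36 : Fin 2 → VertexKind := fun _ => .v18 1 0

/-- the φ′-leg `j` (`j = 0`: the differentiated = arrowed one) of the vertex `i` of (3.6)₁. [cite: Balaban1983Higgs3, (1.17) p.415] -/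
def sLeg (i j : Fin 2) : Leg kind36 := ⟨i, .inl j⟩

/-- the A′-leg (wavy) of the vertex `i` of (3.6)₁. [cite: Balaban1983Higgs3, (1.17) p.415] -/
def vLeg (i : Fin 2) : Leg kind36 := ⟨i, .inr ⟨0, by show 0 < 1; exact Nat.one_pos⟩⟩

/-- The lines of (3.6)₁ as the pairing «other endpoint» (p18's `g36a.other`, verbatim): the φ′-line joins the two differentiated legs,
the A′-line the two A′-legs, the undifferentiated φ′-legs are external. [cite: Balaban1983Higgs3, (3.6) p.435] -/
def other36 : Leg kind36 → Option (Leg kind36)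
  | ⟨i, .inl j⟩ => if j.val = 0 then some ⟨i.rev, .inl ⟨0, by simp [kind36, VertexKind.scalarLegs]⟩⟩ else none
  | ⟨i, .inr _⟩ => some ⟨i.rev, .inr ⟨0, by simp [kind36, VertexKind.vectorLegs]⟩⟩

variable (hn : 1 ≤ nbar)

/-- p18's `g36a` has the vertices `kind36` … [cite: Balaban1983Higgs3, (3.6) p.435] -/
theorem g36a_kind : (g36a nbar hn).kind = kind36 := rfl

/-- … two of them … [cite: Balaban1983Higgs3, (3.6) p.435] -/
theorem g36a_nV : (g36a nbar hn).nV = 2 := rfl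

/-- … and the lines `other36` (definitionally). [cite: Balaban1983Higgs3, (3.6) p.435] -/
theorem g36a_other (x : Leg kind36) : (g36a nbar hn).other x = other36 x := by
  obtain ⟨i, y⟩ := x
  rcases y with j | j <;> rfl

/-- Every leg of (3.6)₁ is one of the four φ′-legs or one of the two A′-legs. [cite: Balaban1983Higgs3, (3.6) p.435] -/
theorem leg_cases (x : Leg kind36) : (∃ i j, x = sLeg i j) ∨ ∃ i, x = vLeg i := by
  obtain ⟨i, y⟩ := x
  rcases y with j | j
  · exact Or.inl ⟨i, j, rfl⟩
  · refine Or.inr ⟨i, ?_⟩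
    have hj : j = ⟨0, by show 0 < 1; exact Nat.one_pos⟩ := Fin.ext (by have h1 : j.val < 1 := j.isLt; show j.val = 0; omega)
    subst hj; rfl

/-- **The φ′-line of (3.6)₁ joins the two DIFFERENTIATED (arrowed) φ′-legs**: the other endpoint of the leg `0` of `x` is the leg
`0` of `x′` and conversely. [cite: Balaban1983Higgs3, (3.6) p.435] -/
theorem g36a_other_sLeg0 (i : Fin 2) : (g36a nbar hn).other (sLeg i 0) = some (sLeg i.rev 0) := by
  fin_cases i <;> rfl

/-- The undifferentiated φ′-legs of (3.6)₁ are external. [cite: Balaban1983Higgs3, (3.6) p.435] -/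
theorem g36a_other_sLeg1 (i : Fin 2) : (g36a nbar hn).other (sLeg i 1) = none := by
  fin_cases i <;> rfl

/-- **The A′-line (wavy) of (3.6)₁ joins the two A′-legs.** [cite: Balaban1983Higgs3, (3.6) p.435] -/
theorem g36a_other_vLeg (i : Fin 2) : (g36a nbar hn).other (vLeg i) = some (vLeg i.rev) := by
  fin_cases i <;> rfl

/-- **The external legs of (3.6)₁ are exactly the two undifferentiated φ′-legs**, one at `x`, one at `x′`.
[cite: Balaban1983Higgs3, (3.6) p.435] -/
theorem other36_eq_none_iff : ∀ x : Leg kind36, other36 x = none ↔ x = sLeg 0 1 ∨ x = sLeg 1 1 := by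
  decide

/-- the same for p18's `g36a` (definitionally `other36`). [cite: Balaban1983Higgs3, (3.6) p.435] -/
theorem g36a_other_eq_none_iff (x : Leg kind36) : (g36a nbar hn).other x = none ↔ x = sLeg 0 1 ∨ x = sLeg 1 1 :=
  other36_eq_none_iff x

/-! ### The pictures (3.6), (3.7), (3.8) -/

/-- **(3.6)₁** p. 435 [PDF 25] as a localized picture: p18's `g36a` (two vertices (1.8)_{1,0} `x = 0`, `x′ = 1`; the φ′-line through
both differentiated legs; the A′-line), each external φ′-leg at its own vertex. [cite: Balaban1983Higgs3, (3.6) p.435] -/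
def pic36a (hn : 1 ≤ nbar) : LocPicture nbar := LocPicture.natural (g36a nbar hn)

/-- **(3.6)₂** p. 435: the A′-tadpole at (1.10)_{2,0} (p18's `g36b`), natural localization. [cite: Balaban1983Higgs3, (3.6) p.435] -/
def pic36b (hn2 : 2 ≤ nbar) : LocPicture nbar := LocPicture.natural (g36b nbar hn2)

/-- **(3.6)₃** p. 435: the φ′-tadpole at (1.6) (p18's `g36c`), natural localization. [cite: Balaban1983Higgs3, (3.6) p.435] -/
def pic36c : LocPicture nbar := LocPicture.natural (g36c nbar)

/-- The localization of (3.7)₁ in closed form: a leg on an internal line stays at its vertex, an external leg goes to `x = 0`.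
[cite: Balaban1983Higgs3, p.417] -/
def loc37 : Leg kind36 → Fin 2 := fun x => if (other36 x).isSome then x.1 else 0

/-- **(3.7)₁** p. 435 [PDF 25] (the picture multiplied by `(−1)`): by p. 417 *"the same graph G but with both external legs localized
in x"* — p18's `g36a` with every EXTERNAL leg localized at the vertex `x = 0` (drawn: the vertex `x` carries both external φ′-legs; the
wavy A′-line and the arrowed φ′-line run from `x` to the second vertex `x′`, where they meet). [cite: Balaban1983Higgs3, (3.7) p.435] -/
def pic37a (hn : 1 ≤ nbar) : LocPicture nbar where
  G := g36a nbar hn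
  loc := loc37
  loc_int x hx := by
    have hx' : (other36 x).isSome := by rw [← g36a_other hn x]; exact hx
    show loc37 x = x.1
    simp only [loc37, hx', if_true]

/-- **(3.7)₂** p. 435: the counterterm picture of the A′-tadpole IS the A′-tadpole (one vertex: both legs are at `x` already).
[cite: Balaban1983Higgs3, (3.7) p.435] -/
def pic37b (hn2 : 2 ≤ nbar) : LocPicture nbar := LocPicture.natural (g36b nbar hn2)

/-- **(3.7)₃** p. 435: the counterterm picture of the φ′-tadpole IS the φ′-tadpole. [cite: Balaban1983Higgs3, (3.7) p.435] -/
def pic37c : LocPicture nbar := LocPicture.natural (g36c nbar)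

/-- **(3.7)** p. 435 [PDF 25], verbatim: *"the renormalized class G_ren contains the corresponding mass renormalization counterterms
also: (−1)·[picture], (−1)·[picture], (−1)·[picture] (3.7)"* — the three signed pictures. [cite: Balaban1983Higgs3, (3.7) p.435] -/
def gren37 (hn2 : 2 ≤ nbar) : List (ℤ × LocPicture nbar) :=
  [(-1, pic37a (le_trans one_le_two hn2)), (-1, pic37b hn2), (-1, pic37c)]

/-- A formal difference of two pictures, `pos − neg` (the model has no composition of graphs; (3.8) is printed as
[picture] − [picture]). [cite: Balaban1983Higgs3, (3.8) p.435] -/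
structure PictureDiff (nbar : ℕ) where
  /-- the picture with coefficient `+1` -/
  pos : LocPicture nbar
  /-- the picture with coefficient `−1` -/
  neg : LocPicture nbar

/-- **(3.8)** p. 435 [PDF 25]: *"We will consider in detail an expression corresponding to [(3.6)₁] − [the picture of (3.7)₁] (3.8)"*.
[cite: Balaban1983Higgs3, (3.8) p.435] -/
def pic38 (hn : 1 ≤ nbar) : PictureDiff nbar := ⟨pic36a hn, pic37a hn⟩

/-- (3.6)₁: each leg sits at its own vertex. [cite: Balaban1983Higgs3, (3.6) p.435] -/
theorem pic36a_loc (x : Leg kind36) : (pic36a hn).loc x = x.1 := rfl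

/-- (3.7)₁: the localization is `loc37` (definitionally). [cite: Balaban1983Higgs3, (3.7) p.435] -/
theorem pic37a_loc (x : Leg kind36) : (pic37a hn).loc x = loc37 x := rfl

/-- **(3.7)₁: BOTH external legs are localized at `x`** (the vertex `0`), the internal legs stay where they are.
[cite: Balaban1983Higgs3, (3.7) p.435] -/
theorem loc37_eq : ∀ x : Leg kind36, loc37 x = if x = sLeg 0 1 ∨ x = sLeg 1 1 then 0 else x.1 := by
  decide

/-- in particular at the two external legs. [cite: Balaban1983Higgs3, (3.7) p.435] -/
theorem loc37_ext : loc37 (sLeg 0 1) = 0 ∧ loc37 (sLeg 1 1) = 0 := by decide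

/-- (3.7)₁ and (3.6)₁ have the SAME drawn graph (p. 417 *"the same graph G"*). [cite: Balaban1983Higgs3, p.417] -/
theorem pic37a_G : (pic37a hn).G = (pic36a hn).G := rfl

/-- … and differ in the localization of the external leg of `x′`: (3.7)₁ ≠ (3.6)₁ as localized pictures.
[cite: Balaban1983Higgs3, (3.7) p.435] -/
theorem pic37a_ne_pic36a : pic37a hn ≠ pic36a hn := by
  intro h
  have hF : ∀ x : Leg (pic37a hn).G.kind, ((pic37a hn).loc x).val = x.1.val := by
    rw [h]; intro x; rfl
  have h1 : (loc37 (sLeg 1 1)).val = 1 := hF (sLeg 1 1)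
  revert h1
  decide

/-- (3.7)₂ is the tadpole picture (3.6)₂ itself (coefficient `−1` in `gren37`). [cite: Balaban1983Higgs3, (3.7) p.435] -/
theorem pic37b_eq (hn2 : 2 ≤ nbar) : pic37b hn2 = pic36b hn2 := rfl

/-- (3.7)₃ is the tadpole picture (3.6)₃ itself (coefficient `−1` in `gren37`). [cite: Balaban1983Higgs3, (3.7) p.435] -/
theorem pic37c_eq : (pic37c : LocPicture nbar) = pic36c := rfl

/-- The printed coefficients of (3.7): `(−1), (−1), (−1)`. [cite: Balaban1983Higgs3, (3.7) p.435] -/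
theorem gren37_coeffs (hn2 : 2 ≤ nbar) : (gren37 hn2).map Prod.fst = [-1, -1, -1] := rfl

/-- (3.8) = [(3.6)₁] − [(3.7)₁'s picture]. [cite: Balaban1983Higgs3, (3.8) p.435] -/
theorem pic38_pos_neg : (pic38 hn).pos = pic36a hn ∧ (pic38 hn).neg = pic37a hn := ⟨rfl, rfl⟩

/-! ### (2.4) inside (3.6)₁ at the level of drawn graphs -/

/-- **Opening the A′-line of (3.6)₁ gives p18's drawn graph (2.4)** (`B3Graph24Unique.graph24`): the same two vertices (1.8)_{1,0}
(`kind36`) and the same φ′-line through both differentiated legs … [cite: Balaban1983Higgs3, (2.4) p.424] -/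
theorem graph24_kind_other_inl : (graph24 nbar hn).kind = kind36 ∧
    ∀ (i j : Fin 2), (graph24 nbar hn).other (sLeg i j) = (g36a nbar hn).other (sLeg i j) :=
  ⟨rfl, fun _ _ => rfl⟩

/-- … with the A′-legs external in (2.4) and joined in (3.6)₁. [cite: Balaban1983Higgs3, (2.4) p.424] -/
theorem graph24_other_inr (i : Fin 2) :
    (graph24 nbar hn).other (vLeg i) = none ∧ (g36a nbar hn).other (vLeg i) = some (vLeg i.rev) :=
  ⟨rfl, g36a_other_vLeg hn i⟩

/-- Hence the φ′-line block of (3.6)₁ — both vertices with the doubly differentiated scalar line, the A′-line open — is the drawn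
graph (2.4), of degree `0` in every dimension (p18's `graph24_deg`): (3.8) is not primitively divergent.
[cite: Balaban1983Higgs3, (2.4) p.424, (3.8) p.435] -/
theorem deg_sub24_of_g36a (d : ℕ) : (graph24 nbar hn).deg d = 0 := graph24_deg d hn

end Pictures

/-! ## §2 The count datum of (3.6)₁/(3.8) DERIVED from the drawn graph -/

section Derived

open B3Prop1 B3Cor23Concrete B3Sect3LowestOrderGraphs B3Ineq215 B3Ineq213 B3TwoVertexBlocks B3Eq312Member

variable {nbar : ℕ}

/-- The number of differentiations carried by a leg of a model graph: the covariant differentiation of (1.8)/(1.9) acts on the first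
φ′-leg (`diffCount` of the vertex on its leg `0`), no other leg is differentiated (p18's convention, `Graph.intDiffs`).
[cite: Balaban1983Higgs3, (2.1) p.422] -/
def legDiffs (G : Graph nbar) : Leg G.kind → ℕ
  | ⟨i, .inl j⟩ => if j.val = 0 then (G.kind i).diffCount else 0
  | ⟨_, .inr _⟩ => 0

/-- The averaged-vector-leg flag of a leg: `1` for an A′-leg of a vertex of the form (1.14)/(1.15), else `0` ((2.14): *"+ (a number of
legs of l which are averaged vector legs in v)"*). [cite: Balaban1983Higgs3, (2.14) p.427] -/
def legAvg (G : Graph nbar) : Leg G.kind → ℕ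
  | ⟨i, .inr _⟩ => if (G.kind i).isAveragingVertex then 1 else 0
  | ⟨_, .inl _⟩ => 0

/-- **An enumeration of the internal lines of a model graph** as the list l̃ = (l(1), …, l(m)) of (2.14)/(2.16): each listed line is a
pair of legs paired by `other`, every internal line is listed, no line is listed twice, and every vertex is an endpoint of a listed
line (*"every internal line has a vertex at each endpoint"*, p. 415; connected graphs). [cite: Balaban1983Higgs3, (2.16) p.428] -/
structure LineEnum (G : Graph nbar) (m : ℕ) where
  /-- first endpoint (leg) of the line `l` -/
  fst : Fin m → Leg G.kind
  /-- second endpoint (leg) of the line `l` -/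
  snd : Fin m → Leg G.kind
  /-- the two legs of a listed line are paired by the graph -/
  pair : ∀ l, G.other (fst l) = some (snd l)
  /-- every internal line is listed -/
  cover : ∀ x y, G.other x = some y → ∃ l, (fst l = x ∧ snd l = y) ∨ (fst l = y ∧ snd l = x)
  /-- no line is listed twice -/
  nodup : ∀ l l', (fst l = fst l' ∨ fst l = snd l') → l = l'
  /-- every vertex is an endpoint of a line -/
  touches : ∀ v : Fin G.nV, ∃ l, (fst l).1 = v ∨ (snd l).1 = v

/-- **The count datum of a drawn graph with enumerated lines** (p19's `Counts`): endpoints of each line, the differentiations of `v`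
acting on `l` (summed over the endpoints of `l` lying in `v`), the averaged vector legs of `l` in `v`, the proper power
`etaCount(v) − d` of `L^{j(v)}η` of each vertex ((2.1)/(2.14)), and the constants `d, L, δ₁`. [cite: Balaban1983Higgs3, (2.14) p.427] -/
def countsOf (G : Graph nbar) {m : ℕ} (E : LineEnum G m) (d L : ℕ) (δ₁ : ℝ) (hd : 0 < d) (hL : 2 ≤ L) (hδ : 0 < δ₁) :
    Counts (Fin G.nV) m where
  src l := (E.fst l).1
  tgt l := (E.snd l).1
  touches := E.touches
  diffOn v l := (if (E.fst l).1 = v then legDiffs G (E.fst l) else 0) + (if (E.snd l).1 = v then legDiffs G (E.snd l) else 0)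
  vecLegAvg v l := (if (E.fst l).1 = v then legAvg G (E.fst l) else 0) + (if (E.snd l).1 = v then legAvg G (E.snd l) else 0)
  etaPow v := ((G.kind v).etaCount d - d).toNat
  d := d
  L := L
  δ₁ := δ₁
  d_pos := hd
  two_le_L := hL
  δ₁_pos := hδ

variable (hn : 1 ≤ nbar)

/-- The enumeration of the two lines of (3.6)₁ in closed form: line `0` = the φ′-line (`sLeg 0 0`, `sLeg 1 0`), line `1` = the
A′-line (`vLeg 0`, `vLeg 1`). [cite: Balaban1983Higgs3, (3.6) p.435] -/
def fst36 : Fin 2 → Leg kind36 := fun l => if l = 0 then sLeg 0 0 else vLeg 0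

/-- second endpoints of the two lines of (3.6)₁. [cite: Balaban1983Higgs3, (3.6) p.435] -/
def snd36 : Fin 2 → Leg kind36 := fun l => if l = 0 then sLeg 1 0 else vLeg 1

/-- The four properties of an enumeration, DECIDED on the closed form of the drawn graph: the listed legs are paired, every line is
listed once, every vertex is an endpoint. [cite: Balaban1983Higgs3, (2.16) p.428] -/
theorem enum36_props :
    (∀ l : Fin 2, other36 (fst36 l) = some (snd36 l)) ∧
    (∀ x y : Leg kind36, other36 x = some y → ∃ l : Fin 2, (fst36 l = x ∧ snd36 l = y) ∨ (fst36 l = y ∧ snd36 l = x)) ∧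
    (∀ l l' : Fin 2, (fst36 l = fst36 l' ∨ fst36 l = snd36 l') → l = l') ∧
    (∀ v : Fin 2, ∃ l : Fin 2, (fst36 l).1 = v ∨ (snd36 l).1 = v) := by
  refine ⟨by decide, by decide, by decide, by decide⟩

/-- **The lines of (3.6)₁ enumerated as in `B3Eq312Member`**: line `0` = the φ′-line from the differentiated leg of `x` to the
differentiated leg of `x′`, line `1` = the A′-line from `x` to `x′` (p18's `g36a.other` is `other36` definitionally).
[cite: Balaban1983Higgs3, (3.6) p.435] -/
def enum36a : LineEnum (g36a nbar hn) 2 where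
  fst := fst36
  snd := snd36
  pair := enum36_props.1
  cover := enum36_props.2.1
  nodup := enum36_props.2.2.1
  touches := enum36_props.2.2.2

/-- **Line kinds are visible**: line `0` of the enumeration is a SCALAR (φ′, straight) line, line `1` a VECTOR (A′, wavy) line.
[cite: Balaban1983Higgs3, (1.17) p.415] -/
theorem enum36a_kinds :
    ((enum36a hn).fst 0).2.isLeft = true ∧ ((enum36a hn).snd 0).2.isLeft = true ∧
      ((enum36a hn).fst 1).2.isLeft = false ∧ ((enum36a hn).snd 1).2.isLeft = false := by
  show (fst36 0).2.isLeft = true ∧ (snd36 0).2.isLeft = true ∧ (fst36 1).2.isLeft = false ∧ (snd36 1).2.isLeft = false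
  decide

/-- both lines run from `x = 0` to `x′ = 1`. [cite: Balaban1983Higgs3, (3.6) p.435] -/
theorem enum36a_endpoints (l : Fin 2) : (fst36 l).1 = 0 ∧ (snd36 l).1 = 1 := by
  revert l; decide

/-- kernel: equality of count data from equality of their data fields. [folklore] -/
private theorem counts_ext {V : Type} [Fintype V] [DecidableEq V] {m : ℕ} {C C' : Counts V m} (h1 : C.src = C'.src)
    (h2 : C.tgt = C'.tgt) (h3 : C.diffOn = C'.diffOn) (h4 : C.vecLegAvg = C'.vecLegAvg) (h5 : C.etaPow = C'.etaPow)
    (h6 : C.d = C'.d) (h7 : C.L = C'.L) (h8 : C.δ₁ = C'.δ₁) : C = C' := by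
  cases C; cases C'
  simp only at h1 h2 h3 h4 h5 h6 h7 h8
  subst h1 h2 h3 h4 h5 h6 h7 h8
  rfl

/-- The differentiations carried by the legs of (3.6)₁ in closed form: `1` on each differentiated φ′-leg (leg `0` of a vertex (1.8)),
`0` elsewhere. [cite: Balaban1983Higgs3, (2.1) p.422] -/
def legDiffs36 : Leg kind36 → ℕ
  | ⟨_, .inl j⟩ => if j.val = 0 then 1 else 0
  | ⟨_, .inr _⟩ => 0

/-- p18's `g36a` carries the differentiations `legDiffs36` and no averaged legs. [cite: Balaban1983Higgs3, (2.1) p.422] -/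
theorem legDiffs_g36a (x : Leg kind36) : legDiffs (g36a nbar hn) x = legDiffs36 x ∧ legAvg (g36a nbar hn) x = 0 := by
  obtain ⟨i, j | j⟩ := x <;> exact ⟨rfl, rfl⟩

/-- The pattern read off the drawn graph IS `δ38` (both vertices differentiate the line `0`, nothing acts on the line `1`), and no
leg is averaged — DECIDED. [cite: Balaban1983Higgs3, (2.14) p.427] -/
theorem pattern36 : ∀ v l : Fin 2,
    (if (fst36 l).1 = v then legDiffs36 (fst36 l) else 0) + (if (snd36 l).1 = v then legDiffs36 (snd36 l) else 0) = δ38 v l := by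
  decide

/-- **THE COUNT DATUM `graph38` OF `B3Eq312Member` IS THE ONE READ OFF THE DRAWN GRAPH (3.6)₁** (`d = 3`, `L = 2`, `δ₁ = 1`):
endpoints `x → x′` for both lines, the pattern `δ38` (both vertices differentiate the φ′-line `0`, nothing acts on the A′-line `1`),
no averaged legs, proper η-power `0` of (1.8)_{1,0}. [cite: Balaban1983Higgs3, (3.6) p.435, (2.14) p.427] -/
theorem countsOf_g36a :
    countsOf (g36a nbar hn) (enum36a hn) 3 2 1 (by norm_num) le_rfl one_pos = graph38 := by
  refine counts_ext ?_ ?_ ?_ ?_ ?_ rfl rfl rfl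
  · funext l
    show (fst36 l).1 = 0
    exact (enum36a_endpoints l).1
  · funext l
    show (snd36 l).1 = 1
    exact (enum36a_endpoints l).2
  · funext v l
    show (if (fst36 l).1 = v then legDiffs (g36a nbar hn) (fst36 l) else 0) +
        (if (snd36 l).1 = v then legDiffs (g36a nbar hn) (snd36 l) else 0) = δ38 v l
    rw [(legDiffs_g36a hn _).1, (legDiffs_g36a hn _).1]
    exact pattern36 v l
  · funext v l
    show (if (fst36 l).1 = v then legAvg (g36a nbar hn) (fst36 l) else 0) +
        (if (snd36 l).1 = v then legAvg (g36a nbar hn) (snd36 l) else 0) = 0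
    rw [(legDiffs_g36a hn _).2, (legDiffs_g36a hn _).2]
    simp
  · funext v
    show ((VertexKind.v18 1 0).etaCount 3 - 3).toNat = 0
    decide

/-- **D = 0, DERIVED**: shrinking the φ′-line of the drawn graph first, the block `G′₁` of the derived datum has degree `0` (it is the
(2.4)-block), shrinking the A′-line first it has degree `2` — `B3Eq312Member.degQ_one_graph38` transported along `countsOf_g36a`.
[cite: Balaban1983Higgs3, (2.4) p.424, (3.8) p.435] -/
theorem degQ_one_countsOf_g36a (σ : Equiv.Perm (Fin 2)) :
    degQ (relabelCounts (countsOf (g36a nbar hn) (enum36a hn) 3 2 1 (by norm_num) le_rfl one_pos) σ) 1 (0 : Fin 2) =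
      if σ 0 = 0 then 0 else 2 := by
  rw [countsOf_g36a]; exact degQ_one_graph38 σ

/-- … and that degree-`0` block IS a (2.4)-block in p19's sense, for the derived datum. [cite: Balaban1983Higgs3, (2.4) p.424] -/
theorem is24Block_countsOf_g36a (σ : Equiv.Perm (Fin 2)) (h : σ 0 = 0) :
    Is24Block (relabelCounts (countsOf (g36a nbar hn) (enum36a hn) 3 2 1 (by norm_num) le_rfl one_pos) σ) 1 (0 : Fin 2) := by
  rw [countsOf_g36a]; exact is24Block_graph38 σ h

/-- **"(D = −d + 2)"** for the derived datum at `d = 3`: the whole drawn graph has degree `−1` along either ordering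
(`degQ_two_graph38`) — equal to p18's catalogue degree `g36a_deg 3` of the drawn graph (`wholeDeg_graph38_eq_deg`).
[cite: Balaban1983Higgs3, (3.6) p.435] -/
theorem degQ_two_countsOf_g36a (σ : Equiv.Perm (Fin 2)) :
    degQ (relabelCounts (countsOf (g36a nbar hn) (enum36a hn) 3 2 1 (by norm_num) le_rfl one_pos) σ) 2 (0 : Fin 2) = -1 ∧
      (g36a nbar hn).deg 3 = -1 := by
  refine ⟨by rw [countsOf_g36a]; exact degQ_two_graph38 σ, ?_⟩
  rw [g36a_deg]; norm_num

end Derived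

/-! ## §3 The dictionary: localized pictures ↦ expressions ((3.8) ↦ (3.19)-form ↦ (3.9)) -/

section Dictionary

open B3Prop1 B3Cor23Concrete B3Sect3LowestOrderGraphs
open B3Sect3ScalarSelfEnergy B3Sect3Subtraction319 B3Eq330Members

open scoped RealInnerProductSpace

noncomputable section

variable {nbar : ℕ} {P : Params} {j : ℕ} {W : Type*} [NormedAddCommGroup W] [InnerProductSpace ℝ W]

/-- **The expression of a localized picture with two chosen external φ′-legs `e`, `e′`** (fields `φ` on `e`, `φ′` on `e′`) and a
kernel `K` depending on the positions of all vertices: the sum over all vertex positions `xs : vertices → T^{(j)}_η` of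
`η^{(#vertices)·d}·⟪φ(xs(loc e)), K(xs)φ′(xs(loc e′))⟫` — each leg's field evaluated AT ITS LOCALIZATION VERTEX, which is the whole
content of the convention of p. 417.  The kernel (product of the propagators of the lines and the vertex factors) is supplied by
the caller; this is a dictionary for the pictures of Sect. 3, not an evaluator of the model. [cite: Balaban1983Higgs3, p.417] -/
def LocPicture.amp (Pic : LocPicture nbar) (e e' : Leg Pic.G.kind) (η : ℝ) (K : (Fin Pic.G.nV → Site P j) → W →ₗ[ℝ] W)
    (φ φ' : SiteField P j W) : ℝ :=
  ∑ xs : Fin Pic.G.nV → Site P j, η ^ (Pic.G.nV * P.d) * ⟪φ (xs (Pic.loc e)), K xs (φ' (xs (Pic.loc e')))⟫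

/-- The expression of a formal difference of pictures (same legs, same kernel): the difference of the expressions.
[cite: Balaban1983Higgs3, (3.8) p.435] -/
def PictureDiff.amp (D : PictureDiff nbar) (e e' : Leg D.pos.G.kind) (f f' : Leg D.neg.G.kind) (η : ℝ)
    (K : (Fin D.pos.G.nV → Site P j) → W →ₗ[ℝ] W) (K' : (Fin D.neg.G.nV → Site P j) → W →ₗ[ℝ] W) (φ φ' : SiteField P j W) : ℝ :=
  D.pos.amp e e' η K φ φ' - D.neg.amp f f' η K' φ φ'

/-- kernel: a sum over the positions of two vertices is a double sum. [folklore] -/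
private theorem sum_arrow_fin_two {α M : Type*} [Fintype α] [AddCommMonoid M] (f : (Fin 2 → α) → M) :
    ∑ xs : Fin 2 → α, f xs = ∑ a : α, ∑ b : α, f ![a, b] := by
  rw [← (finTwoArrowEquiv α).symm.sum_comp f, Fintype.sum_prod_type]
  rfl

/-- A two-point kernel `Σ(x, x′)` as a function of the positions of the two vertices `x = xs 0`, `x′ = xs 1`.
[cite: Balaban1983Higgs3, (3.9) p.435] -/
def kernel2 (Sg : Site P j → Site P j → W →ₗ[ℝ] W) (xs : Fin 2 → Site P j) : W →ₗ[ℝ] W := Sg (xs 0) (xs 1)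

variable (hn : 1 ≤ nbar)

/-- **(3.6)₁ ↦ the graph term**: with the legs `φ` at `x` and `φ′` at `x′` (each at its own vertex),
`amp = Σ_{x,x′} η^{2d} φ(x)·Σ(x,x′)φ′(x′)`. [cite: Balaban1983Higgs3, (3.9) p.435] -/
theorem amp_pic36a (η : ℝ) (Sg : Site P j → Site P j → W →ₗ[ℝ] W) (φ φ' : SiteField P j W) :
    (pic36a hn).amp (sLeg 0 1) (sLeg 1 1) η (kernel2 Sg) φ φ' =
      ∑ x : Site P j, ∑ x' : Site P j, η ^ (2 * P.d) * ⟪φ x, Sg x x' (φ' x')⟫ := by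
  unfold LocPicture.amp
  show ∑ xs : Fin 2 → Site P j, η ^ (2 * P.d) * ⟪φ (xs 0), kernel2 Sg xs (φ' (xs 1))⟫ = _
  rw [sum_arrow_fin_two]
  rfl

/-- **(3.7)₁ ↦ the counterterm**: with both legs at `x`, `amp = Σ_{x,x′} η^{2d} φ(x)·Σ(x,x′)φ′(x)` …
[cite: Balaban1983Higgs3, (3.9) p.435] -/
theorem amp_pic37a (η : ℝ) (Sg : Site P j → Site P j → W →ₗ[ℝ] W) (φ φ' : SiteField P j W) :
    (pic37a hn).amp (sLeg 0 1) (sLeg 1 1) η (kernel2 Sg) φ φ' =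
      ∑ x : Site P j, ∑ x' : Site P j, η ^ (2 * P.d) * ⟪φ x, Sg x x' (φ' x)⟫ := by
  unfold LocPicture.amp
  rw [pic37a_loc, pic37a_loc, loc37_ext.1, loc37_ext.2]
  show ∑ xs : Fin 2 → Site P j, η ^ (2 * P.d) * ⟪φ (xs 0), kernel2 Sg xs (φ' (xs 0))⟫ = _
  rw [sum_arrow_fin_two]
  rfl

/-- … *"with the summation over x′"* (p. 417): `= Σ_x η^d φ(x)·(Σ_{x′} η^d Σ(x,x′))φ′(x)`, the counterterm form of r15's (3.19)
carrier. [cite: Balaban1983Higgs3, p.417] -/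
theorem amp_pic37a_resummed (η : ℝ) (Sg : Site P j → Site P j → W →ₗ[ℝ] W) (φ φ' : SiteField P j W) :
    (pic37a hn).amp (sLeg 0 1) (sLeg 1 1) η (kernel2 Sg) φ φ' =
      ∑ x : Site P j, η ^ P.d * ⟪φ x, (∑ x' : Site P j, η ^ P.d • Sg x x') (φ' x)⟫ := by
  rw [amp_pic37a]
  refine Finset.sum_congr rfl fun x _ => ?_
  simp only [LinearMap.sum_apply, LinearMap.smul_apply, inner_sum, real_inner_smul_right, Finset.mul_sum]
  refine Finset.sum_congr rfl fun x' _ => ?_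
  rw [two_mul, pow_add]
  ring

/-- **(3.8) ↦ r15's graph-with-counterterm carrier (3.19)**: the expression of the formal difference [(3.6)₁] − [(3.7)₁'s picture]
with a kernel `Σ(x,x′)` on its two lines IS `subtracted319 η Σ φ φ′` = Σ_{x,x′}η^{2d}φ(x)·Σ(x,x′)φ′(x′) − Σ_xη^dφ(x)·(Σ_{x′}η^dΣ(x,x′))φ′(x).
[cite: Balaban1983Higgs3, (3.8) p.435, (3.19) p.438] -/
theorem amp_pic38 (η : ℝ) (Sg : Site P j → Site P j → W →ₗ[ℝ] W) (φ φ' : SiteField P j W) :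
    (pic38 hn).amp (sLeg 0 1) (sLeg 1 1) (sLeg 0 1) (sLeg 1 1) η (kernel2 Sg) (kernel2 Sg) φ φ' =
      subtracted319 η Sg φ φ' := by
  unfold PictureDiff.amp subtracted319
  show (pic36a hn).amp (sLeg 0 1) (sLeg 1 1) η (kernel2 Sg) φ φ' -
      (pic37a hn).amp (sLeg 0 1) (sLeg 1 1) η (kernel2 Sg) φ φ' = _
  rw [amp_pic36a, amp_pic37a_resummed]

/-- **(3.8) ↦ (3.9)**, the printed sentence *"The expression corresponding to (3.8) is (3.9)"*: with the kernel `Σ₃₉` READ OFF THE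
LINES AND VERTICES of (3.6)₁ (this lineage's `sigma39`: the doubly differentiated φ′-line ↦ Σ_μ(∂^η_μG_{(j)}(0)∂^{η*}_μ)(x,x′), the
A′-line ↦ G_{(j′)}(x,x′), the vertices (1.8)_{1,0} ↦ q g(x), q g′(x′)), r15's (3.9) is MINUS the expression of the formal difference
(3.8) — the exterior sign of (3.9), which opens with "−Σ_{x,x′} …" (`expr39_eq_neg_subtracted319`).
[cite: Balaban1983Higgs3, (3.9) p.435] -/
theorem expr39_eq_neg_amp_pic38 (η : ℝ) (q : W →ₗ[ℝ] W) (Gj Gj' : Kernel P j) (g g' : SiteField P j ℝ)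
    (φ φ' : SiteField P j W) :
    expr39 η q Gj Gj' g g' φ φ' =
      -(pic38 hn).amp (sLeg 0 1) (sLeg 1 1) (sLeg 0 1) (sLeg 1 1) η
        (kernel2 (sigma39 η q Gj Gj' g g')) (kernel2 (sigma39 η q Gj Gj' g g')) φ φ' := by
  rw [amp_pic38, expr39_eq_neg_subtracted319]

/-- The two printed terms separately: (3.6)₁ ↦ r15's `graphTerm39`, (3.7)₁'s picture ↦ r15's `counterTerm39` (both with the kernel
`Σ₃₉`; the common exterior sign is carried by `expr39 = −graphTerm39 + counterTerm39`). [cite: Balaban1983Higgs3, (3.9) p.435] -/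
theorem amp_pic36a_pic37a_sigma39 (η : ℝ) (q : W →ₗ[ℝ] W) (Gj Gj' : Kernel P j) (g g' : SiteField P j ℝ)
    (φ φ' : SiteField P j W) :
    (pic36a hn).amp (sLeg 0 1) (sLeg 1 1) η (kernel2 (sigma39 η q Gj Gj' g g')) φ φ' = graphTerm39 η q Gj Gj' g g' φ φ' ∧
      (pic37a hn).amp (sLeg 0 1) (sLeg 1 1) η (kernel2 (sigma39 η q Gj Gj' g g')) φ φ' =
        counterTerm39 η q Gj Gj' g g' φ φ' := by
  constructor
  · rw [amp_pic36a]
    unfold graphTerm39 sigma39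
    refine Finset.sum_congr rfl fun x _ => Finset.sum_congr rfl fun x' _ => ?_
    simp only [LinearMap.smul_apply, LinearMap.coe_comp, Function.comp_apply, real_inner_smul_right]
  · rw [amp_pic37a]
    unfold counterTerm39 sigma39
    refine Finset.sum_congr rfl fun x _ => Finset.sum_congr rfl fun x' _ => ?_
    simp only [LinearMap.smul_apply, LinearMap.coe_comp, Function.comp_apply, real_inner_smul_right]

/-! ### §4 The Wick sentence for the tadpoles, through the dictionary -/

/-- For a ONE-vertex picture (the tadpoles (3.6)₂,₃, whose counterterm pictures (3.7)₂,₃ are the same pictures with coefficient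
`−1`: `pic37b_eq`, `pic37c_eq`, `gren37_coeffs`) with its natural localization every leg sits at the single vertex: its expression
with a position kernel `K` is `Σ_x η^d φ(x)·K(x)φ′(x)` — graph term and counterterm have the same shape, and p. 435's sentence *"The two
last terms in (3.7) cancel exactly the two last terms in (3.6) … (Wick ordering)"* is, at the level of expressions, p18's
`B3Sect3WickCancellation.tadpole_cancellation` (local kernel `η^{−d}·1_{x=x′}·T` in r15's `subtracted319`), not restated here.
[cite: Balaban1983Higgs3, (3.7) p.435] -/
theorem amp_natural_oneVertex (G : Graph nbar) (hG : G.nV = 1) (e e' : Leg G.kind) (η : ℝ)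
    (K : (Fin G.nV → Site P j) → W →ₗ[ℝ] W) (φ φ' : SiteField P j W) :
    (LocPicture.natural G).amp e e' η K φ φ' =
      ∑ xs : Fin G.nV → Site P j, η ^ P.d * ⟪φ (xs e.1), K xs (φ' (xs e.1))⟫ := by
  unfold LocPicture.amp LocPicture.natural
  have he : e'.1 = e.1 := by
    have : Subsingleton (Fin G.nV) := by rw [hG]; infer_instance
    exact Subsingleton.elim _ _
  simp only [hG, one_mul, he]

end

end Dictionary

end Literature.MathematicalPhysics.QuantumFieldTheory.Balaban1983to89.B3Eq37Pictures
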